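import Summits.Ventures.PercRepro.MSTightCompletionDichotomy

/-!
# Corollaries of the completion dichotomy (H3)

Dossier proofs/MINE1-theoremS.md, Addendum 57 §2. With `completion_dichotomy_of_twinFree` and the
counting lemmas of MSTightConjTCompletion.lean (gen 24), at every tightening direction of a
twin-free genuine excess-one family:
* **L1** — `F₀` is tight or `F₁` is tight (`tight_part0_or_tight_partr_of_genuine`), the census
  statement L1 of Addendum 46;
* the type-I differences lie inside the difference family of a TIGHT half:
  `Y ⊆ D(F₀)` with `F₀` tight, or `Y ⊆ D(F₁)` with `F₁` tight (`diffsY_subset_tight_half`);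
* the `r`-differences of the tight completion are exactly `D(F₀)` resp. `D(F₁)`
  (`diffs_proj_part0_or_diffs_partr_proj`).
-/

namespace PercRepro.MSTight

open Finset
open scoped FinsetFamily

variable {α : Type*} [DecidableEq α] [Fintype α] {r : α} {F : Finset (Finset α)}

/-- **L1.** At a tightening direction of a twin-free genuine excess-one family, `F₀` or `F₁` is
tight. -/
theorem tight_part0_or_tight_partr_of_genuine (htw : ∀ a b, Twin F a b → a = b)
    (hF : (F \\ F).card = F.card + 1) (hE : (∅ : Finset α) ∉ F) (hU : (univ : Finset α) ∉ F)
    (hcore : ∀ a, ∃ t ∈ F, a ∉ t) (hsupp : ∀ a, ∃ t ∈ F, a ∈ t) (hP : Tight (proj r F)) :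
    Tight (part0 r F) ∨ Tight (partr r F) := by
  rcases completion_dichotomy_of_twinFree htw hF hE hU hcore hsupp hP with h | h
  · exact Or.inl (tight_part0_of_tight_completion0 hP h)
  · exact Or.inr (tight_partr_of_tight_completion1 hP h)

/-- **The type-I differences lie in the difference family of a tight half:** `F₀` is tight with
`Y ⊆ D(F₀)`, or `F₁` is tight with `Y ⊆ D(F₁)`. -/
theorem diffsY_subset_tight_half (htw : ∀ a b, Twin F a b → a = b)
    (hF : (F \\ F).card = F.card + 1) (hE : (∅ : Finset α) ∉ F) (hU : (univ : Finset α) ∉ F)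
    (hcore : ∀ a, ∃ t ∈ F, a ∉ t) (hsupp : ∀ a, ∃ t ∈ F, a ∈ t) (hP : Tight (proj r F)) :
    (Tight (part0 r F) ∧ diffsY r F ⊆ part0 r F \\ part0 r F) ∨
      (Tight (partr r F) ∧ diffsY r F ⊆ partr r F \\ partr r F) := by
  rcases completion_dichotomy_of_twinFree htw hF hE hU hcore hsupp hP with h | h
  · exact Or.inl ⟨tight_part0_of_tight_completion0 hP h,
      diffsY_subset_diffs_part0_of_tight_completion0 hP h⟩
  · exact Or.inr ⟨tight_partr_of_tight_completion1 hP h,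
      diffsY_subset_diffs_partr_of_tight_completion1 hP h⟩

/-- **The `r`-differences of the tight completion:** `P \\ F₀ = D(F₀)` or `F₁ \\ P = D(F₁)`. -/
theorem diffs_proj_part0_or_diffs_partr_proj (htw : ∀ a b, Twin F a b → a = b)
    (hF : (F \\ F).card = F.card + 1) (hE : (∅ : Finset α) ∉ F) (hU : (univ : Finset α) ∉ F)
    (hcore : ∀ a, ∃ t ∈ F, a ∉ t) (hsupp : ∀ a, ∃ t ∈ F, a ∈ t) (hP : Tight (proj r F)) :
    proj r F \\ part0 r F = part0 r F \\ part0 r F ∨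
      partr r F \\ proj r F = partr r F \\ partr r F := by
  rcases completion_dichotomy_of_twinFree htw hF hE hU hcore hsupp hP with h | h
  · exact Or.inl (diffs_part0_eq_of_tight_completion0 hP h).symm
  · exact Or.inr (diffs_partr_eq_of_tight_completion1 hP h).symm

end PercRepro.MSTight
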